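import Summits.HodgeConjecture.HodgeConjecture.Theorems.K2E1bCDPseudoCoeffDefs         -- ★ U8e DEFS leaf (K2E1b-plan (g4)): `HasFinRankOpTrace`, `IsLeftKFiniteU21`, `hasArchOpTrace_unique`; re-exports ★ U8-0 `HasArchOpTrace`
import Summits.HodgeConjecture.HodgeConjecture.Theorems.K2E1AdmissibleSmearFiniteRank    -- ★ E1 (K2E1-p02 (g4)): `finiteDimensional_homRangeSum_of_admissible`
import Literature.NumberTheory.Automorphic.U21IrreducibleUnitaryKTypeGrowthProofs       -- ★ `kTypeGrowth_uTwoOne` (V19 at `U(2,1)`, PROVED)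
import Mathlib.Analysis.InnerProductSpace.Trace
import Mathlib.Analysis.InnerProductSpace.l2Space
import Mathlib.Analysis.InnerProductSpace.Adjoint
import HarnessLib

/-!
# K2 ∕ E1b tier 1 · unit U8e «CD PSEUDO-COEFFICIENT PARTS» — brick 8a-1 «FINITE-RANK TRACE»: a finite-rank `ϖ(f)` has the basis-free trace
# `HasArchOpTrace` (Parseval), and `ϖ(f)` HAS finite rank for a left-`K`-finite `f` and a unitary globalization `ϖ` of a `(𝔤,K)`-class of `U(2,1)`

Cell hodgecm-mathlib, Track B «K2-LIT», engine E1b = «(𝔤,K)-cohomology of U(2,1)»; crux item h413 = stmt-HodgeConjecture-24833; K2-lead (g1) CHAIR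
RULING R19 «8a IN-HOUSE PARTS (LIMITED)» (2026-09-04T05:10:13Z): socket 8a `sig_K2E1bCDPseudoCoefficient` (Clozel–Delorme pseudo-coefficient with
χ-support, `Cruxes/H413/Lines/K2_E1b_GKCohomologyU21_U8d_CDPseudoCoeff.lean` :149) is re-assembled from FOUR parts (★ `cdPseudoCoeffWith_of_parts`,
`Theorems/K2E1bCDPseudoCoeffOfParts.lean`, K2E1b-plan (g4)): U8e-1 «finite-rank trace ⇒ archimedean trace», U8e-2 «left-`K`-finite ⇒ finite rank»,
U8e-3 the Clozel–Delorme CORE in printed shape (XL, letter-grade), U8e-4 «globalization ⇒ coh-unitary».  THIS FILE (desk K2-defs1 (g4), deal (b) BY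
SPEC, K2-lead (g1) 05:11:39Z; heads conformed to the dealer's EXACT shapes (H1)∕(H2), K2E1b-plan (g4) 05:18:48Z) PAYS U8e-1 and U8e-2:
* **(H1) `hasArchOpTrace_of_hasFinRankOpTrace`** (any topological group `G`, any measure finite on compacta, any unitary strongly continuous `ϖ` on a
  Hilbert space `E`, any `f ∈ C_c(G)`): `HasFinRankOpTrace ν ϖ f c → HasArchOpTrace ν ϖ f c` — if the range of `ϖ(f)` lies in a finite-dimensional
  `W` and `c = tr (ϖ(f)|_W)`, then along EVERY Hilbert basis `b` of `E` the diagonal sums `Σ_k ⟪b k, ϖ(f) b k⟫` converge to `c`.  Proof (§1, pure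
  Hilbert space): expand `T(b k) ∈ W` in an orthonormal basis `e` of `W`, move `T` across with the adjoint, and sum Parseval's identity
  `Σ_k ⟪x, b k⟫⟪b k, y⟫ = ⟪x, y⟫` (Mathlib `HilbertBasis.hasSum_inner_mul_inner`) over the finitely many `i`; the value `Σ_i ⟪e i, T e i⟫` is
  `LinearMap.trace ℂ W (T|_W)` (Mathlib `LinearMap.trace_eq_sum_inner`) [ReedSimon1972, Thm. VI.18 (finite-rank case)]; Mathlib has no trace class and
  none is needed.
* **(H2) `exists_hasFinRankOpTrace_of_isLeftKFiniteU21`** (`U(2,1)`, Haar `ν`, `ϖ` a unitary globalization of a `(𝔤,K)`-class `x`, `f` left-`K`-finite,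
  ★ `IsLeftKFiniteU21`): `∃ c, HasFinRankOpTrace ν ϖ f c`, i.e. `ϖ(f)` HAS FINITE RANK.  Proof (§2, any topological group `G`, compact `K → G`,
  left-invariant `ν`): for `f` whose left translates `λ(k)f = f(k⁻¹·)` span a finite-dimensional `F₀`, the map `φ ↦ ∫ φ(g) ϖ(g)v dν` is a `K`-map from
  `(F₀, λ)` to `ϖ|_K` because `ϖ(λ(k)φ) = ϖ(k)ϖ(φ)` for left-invariant `ν` (Mathlib `integral_mul_left_eq_self`), so every `ϖ(f)v` lies in the `F₀`-part
  `Σ_{T ∈ Hom_K(F₀, ϖ|_K)} im T` of `ϖ|_K` (★ `Representation.homRangeSum`), ONE subspace for all `v`, finite-dimensional under admissibility on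
  irreducible `K`-types by ★ E1 `K2E1AdmissibleSmearFiniteRank.finiteDimensional_homRangeSum_of_admissible` [WallachRRG1, §3.3.1; Knapp1986,
  Prop. 10.8 ∕ (10.9)]; at `U(2,1)` admissibility of a unitary globalization is ★ `kTypeGrowth_uTwoOne` (`.1`).  One side of `K`-finiteness suffices
  (print's `f ∈ C_c^∞(G, K)` is bi-`K`-finite [ClozelDelorme1990, §1 p. 194]); no smoothness of `f` is used.  The `K`-action on functions is carried
  as an arbitrary `ρ : Representation ℂ K (G → ℂ)` with `ρ k φ x = φ((i k)⁻¹ x)` (plain functions, Mathlib `Pi` module structure, so that E1's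
  theorem elaborates at `V := ↥F₀`); `IsLeftKFiniteU21` (★ `leftTranslate` on `C(U(2,1), ℂ)`) is moved across by `ContinuousMap.coeFnLinearMap`.
THEOREMS ONLY (no `def`, no `instance`, no notation, no `sorry`, no axiom beyond the standard trio); lane `--supports stmt-HodgeConjecture-24833 --as helper`.
References: [ReedSimon1972] M. Reed, B. Simon, *Methods of Modern Mathematical Physics I* (1972), Thm. VI.18; [Knapp1986] A. W. Knapp, *Representation
Theory of Semisimple Groups* (1986), Prop. 10.8, (10.9), Thm. 10.2; [WallachRRG1] N. R. Wallach, *Real Reductive Groups I* (1988), §1.4.7, §3.3.1, §8.1.1;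
[ClozelDelorme1990] L. Clozel, P. Delorme, Ann. Sci. ÉNS 23 (1990), §1 p. 194, Cor. p. 213; [BrockerTomDieck1985] II (1.9), III (5.5); [DeitmarEchterhoff2014] Prop. 6.2.1.
HONEST LABEL: HC_CM is proved only modulo the 7 printed citations (2 remaining named inputs: hLiu418 = stmt-HodgeConjecture-24832,
h413 = stmt-HodgeConjecture-24833) until rung 0 closes; this file is a count-neutral helper paying the in-house parts U8e-1∕U8e-2: 8a stays a
letter-grade named input (Clozel–Delorme, U8e-3) — the parts isolate it, they do not remove it.
-/

set_option autoImplicit false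
set_option linter.dupNamespace false

noncomputable section

open MeasureTheory Measure CompactlySupported Filter Topology
open scoped InnerProductSpace

namespace Summit.HodgeConjecture.HodgeConjecture.Cruxes.H413.K2E1bGKCohomologyU21.U8

open Literature.NumberTheory.Automorphic
open Literature.RepresentationTheory.KonnoKonno2007 Literature.RepresentationTheory.KonnoKonno2007.RealDualPair
open Summit.HodgeConjecture.HodgeConjecture.Cruxes.H413.K2E1AdmissibleSmearFiniteRank (finiteDimensional_homRangeSum_of_admissible)

namespace FiniteRankTrace

/-! ## §1 Finite-rank operators on a Hilbert space have a basis-free trace (Parseval) -/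

section HilbertSpace

variable {E : Type*} [NormedAddCommGroup E] [InnerProductSpace ℂ E]

/-- Orthonormal expansion inside the finite-dimensional target: if `T v ∈ W` and `e` is an orthonormal basis of `W` then `T v = Σ_i ⟪e i, T v⟫ e i`.
[cite: ReedSimon1972, Thm. II.6] -/
theorem apply_eq_sum_inner_smul (T : E →L[ℂ] E) (W : Submodule ℂ E) {ι : Type*} [Fintype ι] (e : OrthonormalBasis ι ℂ W)
    {v : E} (hv : T v ∈ W) :
    T v = ∑ i, ⟪((e i : W) : E), T v⟫_ℂ • ((e i : W) : E) := by
  have h := congrArg (fun x : W => (x : E)) (e.sum_repr' ⟨T v, hv⟩)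
  simp only [Submodule.coe_sum, Submodule.coe_smul, Submodule.coe_inner] at h
  exact h.symm

/-- The sum `Σ_i ⟪e i, T (e i)⟫` over an orthonormal basis `e` of a `T`-stable finite-dimensional `W` is the trace of the restriction `T|_W : W → W`
(Mathlib `LinearMap.trace_eq_sum_inner`). [cite: ReedSimon1972, Thm. VI.18] -/
theorem sum_inner_apply_eq_trace_restrict (T : E →L[ℂ] E) (W : Submodule ℂ E) {ι : Type*} [Fintype ι] (e : OrthonormalBasis ι ℂ W)
    (hT : ∀ v, T v ∈ W) :
    ∑ i, ⟪((e i : W) : E), T ((e i : W) : E)⟫_ℂ = LinearMap.trace ℂ W ((T : E →ₗ[ℂ] E).restrict (p := W) (q := W) fun v _ => hT v) := by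
  rw [LinearMap.trace_eq_sum_inner _ e]
  refine Finset.sum_congr rfl fun i _ => ?_
  rw [Submodule.coe_inner, LinearMap.coe_restrict_apply, ContinuousLinearMap.coe_coe]

variable [CompleteSpace E]

/-- The diagonal matrix coefficient of a finite-rank operator as a finite sum of products of Fourier coefficients:
`⟪v, T v⟫ = Σ_i ⟪T† e i, v⟫ ⟪v, e i⟫` (`e` an orthonormal basis of a finite-dimensional `W ⊇ range T`). [cite: ReedSimon1972, Thm. VI.18] -/
theorem inner_apply_eq_sum (T : E →L[ℂ] E) (W : Submodule ℂ E) {ι : Type*} [Fintype ι] (e : OrthonormalBasis ι ℂ W)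
    (hT : ∀ v, T v ∈ W) (v : E) :
    ⟪v, T v⟫_ℂ = ∑ i, ⟪ContinuousLinearMap.adjoint T ((e i : W) : E), v⟫_ℂ * ⟪v, ((e i : W) : E)⟫_ℂ := by
  conv_lhs => rw [apply_eq_sum_inner_smul T W e (hT v)]
  rw [inner_sum]
  refine Finset.sum_congr rfl fun i _ => ?_
  rw [inner_smul_right, ContinuousLinearMap.adjoint_inner_left]

/-- **A FINITE-RANK OPERATOR HAS A BASIS-FREE TRACE.**  If `T : E →L[ℂ] E` takes its values in a finite-dimensional subspace `W` with orthonormal basis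
`e`, then for EVERY Hilbert basis `b` of `E` the diagonal sums `Σ_k ⟪b k, T (b k)⟫` converge (unconditionally, `HasSum`) to `Σ_i ⟪e i, T (e i)⟫`:
Parseval `Σ_k ⟪x, b k⟫⟪b k, y⟫ = ⟪x, y⟫` (Mathlib `HilbertBasis.hasSum_inner_mul_inner`) with `x = T† e i`, `y = e i`, summed over the finitely many `i`.
[cite: ReedSimon1972, Thm. VI.18] [cite: Knapp1986, Thm. 10.2 (finite-rank case)] -/
theorem hasSum_inner_apply_of_forall_mem (T : E →L[ℂ] E) (W : Submodule ℂ E) {ι : Type*} [Fintype ι] (e : OrthonormalBasis ι ℂ W)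
    (hT : ∀ v, T v ∈ W) {κ : Type*} (b : HilbertBasis κ ℂ E) :
    HasSum (fun k : κ => ⟪(b k : E), T (b k)⟫_ℂ) (∑ i, ⟪((e i : W) : E), T ((e i : W) : E)⟫_ℂ) := by
  have h : ∀ i : ι, HasSum (fun k : κ => ⟪ContinuousLinearMap.adjoint T ((e i : W) : E), (b k : E)⟫_ℂ * ⟪(b k : E), ((e i : W) : E)⟫_ℂ)
      ⟪((e i : W) : E), T ((e i : W) : E)⟫_ℂ := fun i => by
    have hP := b.hasSum_inner_mul_inner (ContinuousLinearMap.adjoint T ((e i : W) : E)) ((e i : W) : E)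
    rwa [ContinuousLinearMap.adjoint_inner_left] at hP
  have hs := hasSum_sum (s := (Finset.univ : Finset ι)) fun i _ => h i
  refine hs.congr_fun ?_
  intro k
  exact inner_apply_eq_sum T W e hT (b k)

/-- **The basis-free trace of a finite-rank operator is `tr (T|_W)`** for ANY finite-dimensional `W ⊇ range T`: along every Hilbert basis `b`,
`Σ_k ⟪b k, T (b k)⟫ = LinearMap.trace ℂ W (T|_W)` (`HasSum`). [cite: ReedSimon1972, Thm. VI.18] -/
theorem hasSum_inner_apply_trace_restrict (T : E →L[ℂ] E) (W : Submodule ℂ E) [FiniteDimensional ℂ W] (hT : ∀ v, T v ∈ W)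
    {κ : Type*} (b : HilbertBasis κ ℂ E) :
    HasSum (fun k : κ => ⟪(b k : E), T (b k)⟫_ℂ) (LinearMap.trace ℂ W ((T : E →ₗ[ℂ] E).restrict (p := W) (q := W) fun v _ => hT v)) := by
  rw [← sum_inner_apply_eq_trace_restrict T W (stdOrthonormalBasis ℂ W) hT]
  exact hasSum_inner_apply_of_forall_mem T W (stdOrthonormalBasis ℂ W) hT b

end HilbertSpace

/-! ## §2 Left-`K`-finite test functions act by finite-rank operators in representations admissible on irreducible `K`-types -/

section Group

variable {G : Type*} [Group G] {K : Type*} [Group K]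

/-- The span of an orbit `{ρ(k) f}` of a representation is `ρ`-stable (`ρ(k) ρ(k') f = ρ(k k') f`). [folklore] -/
theorem apply_mem_span_orbit {V : Type*} [AddCommGroup V] [Module ℂ V] (ρ : Representation ℂ K V) (f : V) (k : K) {φ : V}
    (hφ : φ ∈ Submodule.span ℂ (Set.range fun k : K => ρ k f)) :
    ρ k φ ∈ Submodule.span ℂ (Set.range fun k : K => ρ k f) := by
  induction hφ using Submodule.span_induction with
  | mem x hx =>
    obtain ⟨k', rfl⟩ := hx
    rw [← Module.End.mul_apply, ← map_mul]
    exact Submodule.subset_span ⟨k * k', rfl⟩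
  | zero =>
    rw [map_zero]
    exact zero_mem _
  | add x y _ _ hx hy =>
    rw [map_add]
    exact add_mem hx hy
  | smul c x _ hx =>
    rw [map_smul]
    exact Submodule.smul_mem _ c hx

variable [TopologicalSpace G] [IsTopologicalGroup G]

/-- For a left regular action `ρ(k)φ = φ((i k)⁻¹ ·)` on functions `G → ℂ`, every function in the span of the translates `ρ(k) f` (`k ∈ K`) of a
continuous compactly supported `f` is continuous with compact support (translates: composition with the homeomorphism `x ↦ (i k)⁻¹x`). [folklore] -/
theorem continuous_and_hasCompactSupport_of_mem_span (i : K →* G) (ρ : Representation ℂ K (G → ℂ))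
    (hρ : ∀ (k : K) (φ : G → ℂ) (x : G), ρ k φ x = φ ((i k)⁻¹ * x)) (f : C_c(G, ℂ)) {φ : G → ℂ}
    (hφ : φ ∈ Submodule.span ℂ (Set.range fun k : K => ρ k (⇑f))) :
    Continuous φ ∧ HasCompactSupport φ := by
  induction hφ using Submodule.span_induction with
  | mem x hx =>
    obtain ⟨k, rfl⟩ := hx
    have h : ρ k (⇑f) = (⇑f) ∘ (Homeomorph.mulLeft (i k)⁻¹) := by
      funext x
      exact hρ k (⇑f) x
    beta_reduce
    rw [h]
    exact ⟨f.continuous.comp (Homeomorph.mulLeft (i k)⁻¹).continuous, f.hasCompactSupport.comp_homeomorph _⟩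
  | zero => exact ⟨continuous_zero, HasCompactSupport.zero⟩
  | add x y _ _ hx hy => exact ⟨hx.1.add hy.1, hx.2.add hy.2⟩
  | smul c x _ hx =>
    refine ⟨hx.1.const_smul c, ?_⟩
    have h : c • x = (fun _ : G => c) • x := rfl
    rw [h]
    exact hx.2.smul_left

variable [TopologicalSpace K]

/-- **Strong continuity of the left regular action** along a continuous `i : K → G` on a stable subspace of continuous functions: for `φ ∈ S`,
`k ↦ ρ(k)φ` is continuous into `S` (pointwise `k ↦ φ((i k)⁻¹x)`, product topology on `G → ℂ`, subspace topology on `S`). [cite: BrockerTomDieck1985, III (5.5)] -/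
theorem continuous_subrepresentation_apply (i : K →* G) (hi : Continuous i) (ρ : Representation ℂ K (G → ℂ))
    (hρ : ∀ (k : K) (φ : G → ℂ) (x : G), ρ k φ x = φ ((i k)⁻¹ * x)) (S : Subrepresentation ρ)
    (hS : ∀ φ ∈ S.toSubmodule, Continuous φ) (φ : S.toSubmodule) :
    Continuous fun k : K => S.toRepresentation k φ := by
  refine continuous_induced_rng.2 (continuous_pi fun x => ?_)
  have h2 : (fun k : K => (Subtype.val ∘ fun k : K => S.toRepresentation k φ) k x) = fun k => (φ : G → ℂ) ((i k)⁻¹ * x) := by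
    funext k
    exact hρ k φ x
  rw [h2]
  exact (hS φ φ.2).comp (hi.inv.mul continuous_const)

/-- **Weak continuity from strong continuity on a finite-dimensional space**: if `k ↦ ρ(k)v` is continuous for every `v` in a finite-dimensional Hausdorff
topological vector space `V`, then every matrix coefficient `k ↦ ℓ(ρ(k)v)` is continuous (linear functionals on `V` are continuous, Mathlib
`LinearMap.continuous_of_finiteDimensional`) — the hypothesis `hρ` of ★ `finiteDimensional_homRangeSum_of_admissible`. [cite: BrockerTomDieck1985, II (1.9)] -/
theorem continuous_dual_apply_of_continuous {V : Type*} [AddCommGroup V] [Module ℂ V] [TopologicalSpace V] [IsTopologicalAddGroup V]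
    [ContinuousSMul ℂ V] [T2Space V] [FiniteDimensional ℂ V] (ρ : Representation ℂ K V)
    (hρ : ∀ v : V, Continuous fun k : K => ρ k v) (v : V) (ℓ : Module.Dual ℂ V) :
    Continuous fun k : K => ℓ (ρ k v) :=
  (LinearMap.continuous_of_finiteDimensional ℓ).comp (hρ v)

variable {E : Type*} [NormedAddCommGroup E] [InnerProductSpace ℂ E] [CompleteSpace E] {ϖ : ContRepresentation ℂ G E}
  [MeasurableSpace G] [BorelSpace G]

/-- **Left translation law of the integrated operator** (left-invariant `ν`): `∫ φ(κ⁻¹g) ϖ(g)v dν(g) = ϖ(κ) ∫ φ(g) ϖ(g)v dν(g)`, i.e.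
`ϖ(λ(κ)φ) = ϖ(κ) ∘ ϖ(φ)` for continuous compactly supported `φ` (substitute `g ↦ κg`, Mathlib `integral_mul_left_eq_self`, and pull the bounded operator
`ϖ(κ)` through the Bochner integral). [cite: DeitmarEchterhoff2014, Prop. 6.2.1] [cite: Knapp1986, (10.9)] -/
theorem integral_translate_smul_apply (ν : Measure G) [IsFiniteMeasureOnCompacts ν] [ν.IsMulLeftInvariant]
    (hc : ϖ.IsStronglyContinuous) {φ : G → ℂ} (hφ : Continuous φ) (hφs : HasCompactSupport φ) (κ : G) (v : E) :
    ∫ g, φ (κ⁻¹ * g) • ϖ g v ∂ν = ϖ κ (∫ g, φ g • ϖ g v ∂ν) := by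
  have hint : Integrable (fun g => φ g • ϖ g v) ν :=
    (hφ.smul (hc v)).integrable_of_hasCompactSupport (hφs.smul_right : HasCompactSupport (φ • fun g => ϖ g v))
  rw [← (ϖ κ).integral_comp_comm hint]
  have h1 : (fun g => ϖ κ (φ g • ϖ g v)) = fun g => φ g • ϖ (κ * g) v := by
    funext g
    rw [ContinuousLinearMap.map_smul, map_mul]
    rfl
  rw [h1, ← integral_mul_left_eq_self (fun g => φ (κ⁻¹ * g) • ϖ g v) κ]
  refine integral_congr_ae (Eventually.of_forall fun g => ?_)
  simp only [inv_mul_cancel_left]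

omit [TopologicalSpace K] in
/-- **`φ ↦ ∫ φ(g) ϖ(g)v dν` is a `K`-map** from a stable subspace of continuous compactly supported functions (left regular action along `i`) to `ϖ|_K`,
for left-invariant `ν`: linear in `φ`, and `∫ (λ(k)φ) ϖ v = ϖ(i k) ∫ φ ϖ v` (`integral_translate_smul_apply`). [cite: Knapp1986, (10.9)] [cite: WallachRRG1, §1.4.7] -/
theorem exists_intertwiningMap_integral (i : K →* G) (ρ : Representation ℂ K (G → ℂ))
    (hρ : ∀ (k : K) (φ : G → ℂ) (x : G), ρ k φ x = φ ((i k)⁻¹ * x)) (ν : Measure G) [IsFiniteMeasureOnCompacts ν] [ν.IsMulLeftInvariant]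
    (hc : ϖ.IsStronglyContinuous) (S : Subrepresentation ρ) (hS : ∀ φ ∈ S.toSubmodule, Continuous φ ∧ HasCompactSupport φ) (v : E) :
    ∃ T : S.toRepresentation.IntertwiningMap ((ϖ.restrict i).toRepresentation),
      ∀ φ : S.toSubmodule, T φ = ∫ g, (φ : G → ℂ) g • ϖ g v ∂ν := by
  have hint : ∀ φ : S.toSubmodule, Integrable (fun g => (φ : G → ℂ) g • ϖ g v) ν := fun φ =>
    ((hS φ φ.2).1.smul (hc v)).integrable_of_hasCompactSupport
      ((hS φ φ.2).2.smul_right : HasCompactSupport ((φ : G → ℂ) • fun g => ϖ g v))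
  let Φ : S.toSubmodule →ₗ[ℂ] E :=
    { toFun := fun φ => ∫ g, (φ : G → ℂ) g • ϖ g v ∂ν
      map_add' := fun φ ψ => by
        have h : (fun g => ((φ + ψ : S.toSubmodule) : G → ℂ) g • ϖ g v) =
            fun g => (φ : G → ℂ) g • ϖ g v + (ψ : G → ℂ) g • ϖ g v := by
          funext g
          rw [Submodule.coe_add, Pi.add_apply, add_smul]
        rw [h]
        exact integral_add (hint φ) (hint ψ)
      map_smul' := fun c φ => by
        have h : (fun g => ((c • φ : S.toSubmodule) : G → ℂ) g • ϖ g v) = fun g => c • ((φ : G → ℂ) g • ϖ g v) := by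
          funext g
          rw [Submodule.coe_smul, Pi.smul_apply, smul_eq_mul, mul_smul]
        rw [h, integral_smul]
        rfl }
  have hΦ : ∀ φ : S.toSubmodule, Φ φ = ∫ g, (φ : G → ℂ) g • ϖ g v ∂ν := fun φ => rfl
  have hR : ∀ (k : K) (w : E), ((ϖ.restrict i).toRepresentation) k w = ϖ (i k) w := fun k w => rfl
  have hSk : ∀ (k : K) (φ : S.toSubmodule), ((S.toRepresentation k φ : S.toSubmodule) : G → ℂ) = ρ k (φ : G → ℂ) := fun k φ => rfl
  refine ⟨Φ.intertwiningMap_of_isIntertwiningMap S.toRepresentation ((ϖ.restrict i).toRepresentation) fun k φ => ?_, fun φ => rfl⟩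
  rw [hΦ, hΦ, hR, hSk]
  simp only [hρ]
  exact integral_translate_smul_apply ν hc (hS φ φ.2).1 (hS φ φ.2).2 (i k) v

variable [IsTopologicalGroup K] [CompactSpace K]

/-- **ALL `ϖ(f)v` LIE IN ONE FINITE-DIMENSIONAL SUBSPACE** when `f ∈ C_c(G)` is LEFT `K`-FINITE and `ϖ` is ADMISSIBLE ON IRREDUCIBLE `K`-TYPES.
`G` a topological group, `i : K → G` a continuous homomorphism from a compact group, `ρ` the left regular action of `K` along `i` on functions
(`ρ(k)φ = φ((i k)⁻¹·)`), `ν` left-invariant and finite on compacta, `ϖ` unitary and strongly continuous with E1's admissibility hypothesis `hadm` on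
`ϖ|_K = ϖ.restrict i` (every finite-dimensional irreducible `K`-stable `E' ≤ E` has a finite-dimensional isotypic part), `f` with all `ρ(k) f` in a
finite-dimensional `F ≤ (G → ℂ)`.  Then there is a finite-dimensional `W ≤ E` with `ϖ(f) v ∈ W` for every `v`: `φ ↦ ∫ φ(g)ϖ(g)v dν` is a `K`-map from
the span `F₀` of the translates to `ϖ|_K` (`exists_intertwiningMap_integral`), so `ϖ(f)v` lies in the `F₀`-part `Σ_{T ∈ Hom_K(F₀, ϖ|_K)} im T`
(★ `Representation.homRangeSum`), finite-dimensional by ★ `finiteDimensional_homRangeSum_of_admissible` (the action on `F₀` is weakly continuous: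
`continuous_subrepresentation_apply`, `continuous_dual_apply_of_continuous`). [cite: WallachRRG1, §3.3.1] [cite: Knapp1986, Prop. 10.8]
[cite: DeitmarEchterhoff2014, Prop. 6.2.1] -/
theorem exists_finiteDimensional_forall_integratedOperator_mem (i : K →* G) (hi : Continuous i) (ρ : Representation ℂ K (G → ℂ))
    (hρ : ∀ (k : K) (φ : G → ℂ) (x : G), ρ k φ x = φ ((i k)⁻¹ * x))
    (ν : Measure G) [IsFiniteMeasureOnCompacts ν] [ν.IsMulLeftInvariant] (hu : ϖ.IsUnitary) (hc : ϖ.IsStronglyContinuous)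
    (hadm : ∀ (E' : Submodule ℂ E) (hE' : ∀ k, ∀ x ∈ E', (ϖ.restrict i) k x ∈ E'), FiniteDimensional ℂ E' →
      ((ϖ.restrict i).subRep E' hE').IsIrreducible →
      FiniteDimensional ℂ (Representation.homRangeSum (ϖ.restrict i).toRepresentation ((ϖ.restrict i).subRep E' hE')))
    (f : C_c(G, ℂ)) (hf : ∃ F : Submodule ℂ (G → ℂ), FiniteDimensional ℂ F ∧ ∀ k : K, ρ k (⇑f) ∈ F) :
    ∃ W : Submodule ℂ E, FiniteDimensional ℂ W ∧ ∀ v : E, ϖ.integratedOperator hu hc ν f v ∈ W := by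
  obtain ⟨F, hF, hfF⟩ := hf
  haveI : FiniteDimensional ℂ F := hF
  -- the span `F₀` of the left `K`-translates: finite-dimensional, `K`-stable, contains `f`, continuous compactly supported functions
  let F₀ : Submodule ℂ (G → ℂ) := Submodule.span ℂ (Set.range fun k : K => ρ k (⇑f))
  have hF₀le : F₀ ≤ F := Submodule.span_le.2 (by rintro _ ⟨k, rfl⟩; exact hfF k)
  haveI hF₀fin : FiniteDimensional ℂ F₀ := Submodule.finiteDimensional_of_le hF₀le
  have hfF₀ : (⇑f : G → ℂ) ∈ F₀ := by
    have h1 : ρ 1 (⇑f) = ⇑f := by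
      rw [map_one]
      rfl
    rw [← h1]
    exact Submodule.subset_span ⟨1, rfl⟩
  let S : Subrepresentation ρ := ⟨F₀, fun k φ hφ => apply_mem_span_orbit ρ (⇑f) k hφ⟩
  haveI : FiniteDimensional ℂ S.toSubmodule := hF₀fin
  have hS : ∀ φ ∈ S.toSubmodule, Continuous φ ∧ HasCompactSupport φ := fun φ hφ =>
    continuous_and_hasCompactSupport_of_mem_span i ρ hρ f hφ
  -- the `F₀`-part of `ϖ|_K` is finite-dimensional (E1's admissibility theorem; weak continuity of the left regular action)
  haveI hW : FiniteDimensional ℂ (Representation.homRangeSum ((ϖ.restrict i).toRepresentation) S.toRepresentation) :=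
    finiteDimensional_homRangeSum_of_admissible hadm S.toRepresentation
      (continuous_dual_apply_of_continuous S.toRepresentation
        (continuous_subrepresentation_apply i hi ρ hρ S fun φ hφ => (hS φ hφ).1))
  refine ⟨_, hW, fun v => ?_⟩
  -- `ϖ(f)v` is the value at `f ∈ F₀` of the `K`-map `φ ↦ ∫ φ ϖ v`
  obtain ⟨T, hT⟩ := exists_intertwiningMap_integral i ρ hρ ν hc S hS v
  have h : ϖ.integratedOperator hu hc ν f v = T ⟨(⇑f : G → ℂ), hfF₀⟩ := by
    rw [hT]
    rfl
  rw [h]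
  exact Representation.apply_mem_homRangeSum T _

end Group

end FiniteRankTrace

/-! ## §3 The heads: socket U8e-1 (generic) and socket U8e-2 (`U(2,1)`) of `Theorems/K2E1bCDPseudoCoeffOfParts.lean` -/

/-- **(H1) — socket U8e-1 «FINITE-RANK TRACE ⇒ ARCHIMEDEAN TRACE» (token for token `FinRankTraceHasArchOpTraceStmt` at every `G`, `E`).**  For any
topological group `G`, measure `ν` finite on compacta, unitary strongly continuous `ϖ` on a Hilbert space `E` and `f ∈ C_c(G)`: if `ϖ(f)` has finite rank
with finite-rank trace `c` (★ `HasFinRankOpTrace`: some finite-dimensional `W ⊇ range ϖ(f)` with `tr (ϖ(f)|_W) = c`), then `HasArchOpTrace ν ϖ f c` — the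
diagonal sums `Σ_k ⟪b k, ϖ(f) b k⟫` converge to `c` along EVERY Hilbert basis `b` (Parseval, §1).  Together with ★ `hasArchOpTrace_unique` this also shows
that the finite-rank trace does not depend on the choice of `W`. [cite: ReedSimon1972, Thm. VI.18] [cite: Knapp1986, Thm. 10.2 (finite-rank case)] -/
theorem hasArchOpTrace_of_hasFinRankOpTrace {G : Type*} [Group G] [TopologicalSpace G] [MeasurableSpace G] [BorelSpace G]
    (ν : Measure G) [IsFiniteMeasureOnCompacts ν] {E : Type} [NormedAddCommGroup E] [InnerProductSpace ℂ E] [CompleteSpace E]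
    (ϖ : ContRepresentation ℂ G E) (hu : ϖ.IsUnitary) (hsc : ϖ.IsStronglyContinuous) (f : C_c(G, ℂ)) {c : ℂ} :
    HasFinRankOpTrace ν ϖ hu hsc f c → HasArchOpTrace ν ϖ hu hsc f c := by
  rintro ⟨W, hW, hWmem, hc⟩
  haveI : FiniteDimensional ℂ W := hW
  rw [hasArchOpTrace_iff]
  intro κ b
  rw [← hc]
  exact FiniteRankTrace.hasSum_inner_apply_trace_restrict (ϖ.integratedOperator hu hsc ν f) W hWmem b

/-- **(H2) — socket U8e-2 «LEFT-`K`-FINITE ⇒ FINITE RANK» (token for token `LeftKFiniteFinRankStmt`).**  For every `(𝔤,K)`-class `x` of `U(2,1)`, every Borel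
structure and Haar measure `ν` on `U(2,1)`, every unitary globalization `ϖ` of `x` on a Hilbert space `E` and every LEFT-`K`-FINITE `f ∈ C_c(U(2,1))`
(★ `IsLeftKFiniteU21`: the left translates `λ(k)f = f(k⁻¹·)`, `k ∈ K = U(2,1) ∩ U(3)`, lie in a finite-dimensional subspace of `C(U(2,1), ℂ)` — in particular
every bi-`K`-finite `f ∈ C_c^∞(G, K)` of print), the operator `ϖ(f)` HAS FINITE RANK: `∃ c, HasFinRankOpTrace ν ϖ f c`.  Admissibility of `ϖ|_K` on
irreducible `K`-types is ★ `kTypeGrowth_uTwoOne` (`.1`); finite rank by §2 (the left regular action is run on plain functions `U(2,1) → ℂ`,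
`IsLeftKFiniteU21` being moved across by `ContinuousMap.coeFnLinearMap`); `c` = the trace of `ϖ(f)` on the finite-dimensional subspace found.
[cite: ClozelDelorme1990, §1 p. 194 and Cor. p. 213] [cite: WallachRRG1, §3.3.1 and §8.1.1] [cite: Knapp1986, Prop. 10.8] -/
theorem exists_hasFinRankOpTrace_of_isLeftKFiniteU21 :
    ∀ (x : GKIrrClass (uFormGroup (Fin 2) (Fin 1)))
      [MeasurableSpace ↥(uFormGroup (Fin 2) (Fin 1)).carrier] [BorelSpace ↥(uFormGroup (Fin 2) (Fin 1)).carrier]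
      (ν : Measure ↥(uFormGroup (Fin 2) (Fin 1)).carrier) [ν.IsHaarMeasure]
      (E : Type) [NormedAddCommGroup E] [InnerProductSpace ℂ E] [CompleteSpace E]
      (ϖ : ContRepresentation ℂ ↥(uFormGroup (Fin 2) (Fin 1)).carrier E)
      (hϖ : IsUnitaryGlobalization (uFormGroup (Fin 2) (Fin 1)) x ϖ)
      (f : C_c(↥(uFormGroup (Fin 2) (Fin 1)).carrier, ℂ)),
      IsLeftKFiniteU21 f → ∃ c : ℂ, HasFinRankOpTrace ν ϖ hϖ.isUnitary hϖ.isStronglyContinuous f c := by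
  intro x _ _ ν _ E _ _ _ ϖ hϖ f hf
  haveI : CompactSpace (uFormGroup (Fin 2) (Fin 1)).maximalCompact := (uFormGroup (Fin 2) (Fin 1)).compactSpace_maximalCompact
  have hincl : Continuous (Subgroup.inclusion (uFormGroup (Fin 2) (Fin 1)).maximalCompact_le_carrier) :=
    continuous_induced_rng.2 continuous_subtype_val
  -- admissibility of `ϖ|_K` on irreducible `K`-types, BY NAME (★ `kTypeGrowth_uTwoOne`)
  obtain ⟨C, hcg⟩ := kTypeGrowth_uTwoOne x E ϖ hϖ
  have hadm : ∀ (E' : Submodule ℂ E)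
      (hE' : ∀ k, ∀ v ∈ E', (ϖ.restrict (Subgroup.inclusion (uFormGroup (Fin 2) (Fin 1)).maximalCompact_le_carrier)) k v ∈ E'),
      FiniteDimensional ℂ E' →
      ((ϖ.restrict (Subgroup.inclusion (uFormGroup (Fin 2) (Fin 1)).maximalCompact_le_carrier)).subRep E' hE').IsIrreducible →
      FiniteDimensional ℂ (Representation.homRangeSum
        (ϖ.restrict (Subgroup.inclusion (uFormGroup (Fin 2) (Fin 1)).maximalCompact_le_carrier)).toRepresentation
        ((ϖ.restrict (Subgroup.inclusion (uFormGroup (Fin 2) (Fin 1)).maximalCompact_le_carrier)).subRep E' hE')) :=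
    fun E' hE' _ hirr' => (hcg E' ((ϖ.restrict (Subgroup.inclusion (uFormGroup (Fin 2) (Fin 1)).maximalCompact_le_carrier)).subRep E' hE') hirr').1
  -- the left regular action of `K` on functions `U(2,1) → ℂ` (Mathlib `LinearMap.funLeft`)
  let ρ : Representation ℂ ↥(uFormGroup (Fin 2) (Fin 1)).maximalCompact (↥(uFormGroup (Fin 2) (Fin 1)).carrier → ℂ) :=
    { toFun := fun k => LinearMap.funLeft ℂ ℂ fun y : ↥(uFormGroup (Fin 2) (Fin 1)).carrier =>
        (Subgroup.inclusion (uFormGroup (Fin 2) (Fin 1)).maximalCompact_le_carrier k)⁻¹ * y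
      map_one' := by
        refine LinearMap.ext fun φ => funext fun y => ?_
        change φ ((Subgroup.inclusion (uFormGroup (Fin 2) (Fin 1)).maximalCompact_le_carrier 1)⁻¹ * y) = φ y
        rw [map_one, inv_one, one_mul]
      map_mul' := fun k k' => by
        refine LinearMap.ext fun φ => funext fun y => ?_
        change φ ((Subgroup.inclusion (uFormGroup (Fin 2) (Fin 1)).maximalCompact_le_carrier (k * k'))⁻¹ * y) =
          φ ((Subgroup.inclusion (uFormGroup (Fin 2) (Fin 1)).maximalCompact_le_carrier k')⁻¹ *
            ((Subgroup.inclusion (uFormGroup (Fin 2) (Fin 1)).maximalCompact_le_carrier k)⁻¹ * y))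
        rw [map_mul, mul_inv_rev, mul_assoc] }
  have hρ : ∀ (k : ↥(uFormGroup (Fin 2) (Fin 1)).maximalCompact) (φ : ↥(uFormGroup (Fin 2) (Fin 1)).carrier → ℂ)
      (y : ↥(uFormGroup (Fin 2) (Fin 1)).carrier),
      ρ k φ y = φ ((Subgroup.inclusion (uFormGroup (Fin 2) (Fin 1)).maximalCompact_le_carrier k)⁻¹ * y) := fun _ _ _ => rfl
  -- `IsLeftKFiniteU21 f` (translates in a finite-dimensional `F ≤ C(U(2,1), ℂ)`) moved to functions along `ContinuousMap.coeFnLinearMap`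
  obtain ⟨F, hF, hfF⟩ := hf
  haveI : FiniteDimensional ℂ F := hF
  have hf' : ∃ F' : Submodule ℂ (↥(uFormGroup (Fin 2) (Fin 1)).carrier → ℂ), FiniteDimensional ℂ F' ∧
      ∀ k : ↥(uFormGroup (Fin 2) (Fin 1)).maximalCompact, ρ k (⇑f) ∈ F' := by
    refine ⟨F.map (ContinuousMap.coeFnLinearMap ℂ), inferInstance, fun k => ?_⟩
    have h : ρ k (⇑f) = ContinuousMap.coeFnLinearMap ℂ
        (leftTranslate (Subgroup.inclusion (uFormGroup (Fin 2) (Fin 1)).maximalCompact_le_carrier k)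
          (f : C(↥(uFormGroup (Fin 2) (Fin 1)).carrier, ℂ))) := rfl
    rw [h]
    exact Submodule.mem_map_of_mem (hfF k)
  -- finite rank (§2), and the finite-rank trace on the subspace found
  obtain ⟨W, hW, hmem⟩ := FiniteRankTrace.exists_finiteDimensional_forall_integratedOperator_mem
    (Subgroup.inclusion (uFormGroup (Fin 2) (Fin 1)).maximalCompact_le_carrier) hincl ρ hρ ν hϖ.isUnitary hϖ.isStronglyContinuous hadm f hf'
  exact ⟨_, W, hW, hmem, rfl⟩

end Summit.HodgeConjecture.HodgeConjecture.Cruxes.H413.K2E1bGKCohomologyU21.U8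

end
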